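import Literature.IUT.HodgeArakelov.BadPlaceSettingOfUnderlineDeltaIndices
import Literature.IUT.HodgeArakelov.LabelClassesOfCuspsRmk231Proofs
import Literature.AnabelianGeometry.EtaleTheta.MuTwoSettingCLevel

/-!
# B14 «PlusMinusTower.ofCoverModel», PRELIMINARIES at the tempered level: `Π^tp_{X̲_v} ⊴ Π^tp_{C_v}` and the indices
# `[Π^tp_C : Π^tp_X̲] = [Δ^tp_C : Δ^tp_X̲] = 2l` at the [EtTh] model (proof-only)

S. Mochizuki, *Inter-universal Teichmüller theory II*, kurims manuscript (Dec. 2020), §2, Def. 2.3 (i) p. 67: "`Δ^cor_v := Δ^tp_{C_v}`,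
`Π^cor_v := Π^tp_{C_v}` … `Δ̂^±_v` includes as a normal open subgroup of `Δ̂^cor_v` of index `2l` [cf. the discussion preceding [EtTh],
Definition 2.1]" ([IUTchII] Def 2.3 (i), kurims p.67) [claim: Mochizuki2012, status: disputed] (D-0012 claim key; series status DISPUTED —
elementary group theory over abc-iut-L2's [EtTh] data only; nothing of the series is asserted); [EtTh] Def. 1.7 p. 27 ("`X^log → C^log`
… by the natural action of `±1`"), §2 p. 36 ("`Gal(X/C) ≅ ℤ/2ℤ`", "`ι ∈ Δ_C`"), Def. 2.1 p. 36 [cite: MochizukiEtTh2009, Def 2.1 p.36].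
PROOF-ONLY file (abc-iut cell, seat abc-iut-L6-t19 gen 5, HOLDER-DESIGNATE of MERGE-MAP row **B14** «`PlusMinusTower.ofCoverModel`»,
abc-iut-L6-lead §F v1.19e (3); the row itself — the profinite-completion transport — is GATED on abc-iut-L2-d3's W3-L2-02 phase 2).
No definitions; nothing landed is edited; decls are added to abc-iut-L2's namespaces BY NAME over their theorems.

WHAT IS PROVED HERE (everything B14 needs BEFORE completing), over abc-iut-L2-t1's `MuTwoSetting M` (`Π^tp_X ↪ Π^tp_C` = `inclX`,
normal of index `2`) with abc-iut-L2-d3's parameter record `e : M.CLevelData` (open embedding, `augC : Π^tp_C → G_{ℚ_p}`), and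
abc-iut-L2-t7's `Π^tp_X̲ = GtpXu = toZ⁻¹(l·ℤ)` (print's `Π^±_v = Π^tp_{X̲_v}`, finding F-L6t19g5-1):

* `ThetaSetting.mem_GtpXu_iff_exists_pow` — `g ∈ Π^tp_X̲ ⇔ ∃ x, g·x^{-l} ∈ Π^tp_Y` (the `l·ℤ`-level of `Y → X`);
* **`ThetaSetting.map_GtpXu_eq_of_map_GtpY_eq`** — every automorphism of `Π^tp_X` stabilising `Π^tp_Y` stabilises `Π^tp_X̲` (pure
  group theory: `Π^tp_X̲` is described by `l`-th powers modulo `Π^tp_Y`);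
* **`MuTwoSetting.CLevelData.map_inclX_GtpXu_normal`** — `Π^tp_X̲ ⊴ Π^tp_C` ("`Δ̂^±_v` … normal … of `Δ̂^cor_v`", tempered and Π-level),
  granted the printed definition of `Z` as in abc-iut-L2-d3's `map_inclX_GtpY_normal` (hypothesis `Thm16Sub.KerToZIsCompactlyGenerated`,
  abc-iut-L6-d5's L02);
* `MuTwoSetting.index_map_inclX_GtpXu` — `[Π^tp_C : Π^tp_X̲] = 2·l`;
* `MuTwoSetting.CLevelData.relIndex_range_deltaC` — `[Δ^tp_C : Δ^tp_X] = 2` (`X → C` is GEOMETRIC of degree `2`: the geometric element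
  outside `Π^tp_X` of `exists_geometric_not_mem_range`, and abc-iut-L6-t19's prime-index lemma `relIndex_eq_of_prime_relIndex_of_not_le`);
* **`MuTwoSetting.CLevelData.relIndex_map_inclX_GtpXu_deltaC`** — `[Δ^tp_C : Δ^tp_{X̲}] = 2·l` = print's `[Δ̂^cor_v : Δ̂^±_v] = 2l` at the
  tempered level (with `[Δ^tp_X : Δ^tp_{X̲}] = l`, abc-iut-L6-t19's `relIndex_GtpXu_deltaTemp`, transported along the injective `inclX`);
* `MuTwoSetting.relIndex_map_inclX_Huu` — `[Δ^tp_{X̲} : Δ^tp_{X̲̲}] = l` inside `Π^tp_C` (transport of `relIndex_Huu_deltaTemp_inf_GtpXu`).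

So, of the `PlusMinusTower` fields, the tempered shadows of `pmHat_normal`, `deltaPmHat_index` (`2l`), `deltaHat_index` (`l`) are kernel
facts at the model; `deltaHat_normal` (`Δ_{X̲̲} ⊴ Δ_{X̲}`, [EtTh] Prop. 2.2 (ii)) is the OPEN normality input (abc-iut-L2-t8 lineage,
asked 03:48Z); the remaining work of B14 is the profinite-completion transport (abc-iut-L3's `IsProfiniteCompletion` API:
`exists_isProfiniteCompletion`, `exists_extension`, `comap_topologicalClosure_map`).  Nothing here takes a side on [IUTchIII] Cor. 3.12.
-/

noncomputable section

namespace Literature.AnabelianGeometry.EtaleTheta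

open Literature.AnabelianGeometry.SemiGraphs

namespace ThetaSetting

variable {p : ℕ} [Fact p.Prime] (D : ThetaSetting p) (l : ℕ)

/-- **`g ∈ Π^tp_X̲ ⇔ ∃ x, g · x^{-l} ∈ Π^tp_Y`**: the level-`l` subcovering `X̲` of `Y → X` consists of the elements whose image in
`Gal(Y/X) = Z ≅ ℤ` is an `l`-th multiple (`Π^tp_X̲ = toZ⁻¹(l·ℤ)`, `Π^tp_Y = Ker(toZ)`, `toZ` onto). [cite: MochizukiEtTh2009, Def 2.5 (i) p.39] -/
theorem mem_GtpXu_iff_exists_pow (g : D.PiTemp) :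
    g ∈ D.GtpXu l ↔ ∃ x : D.PiTemp, g * (x ^ l)⁻¹ ∈ D.GtpY := by
  constructor
  · intro hg
    obtain ⟨k, hk⟩ := Subgroup.mem_zpowers_iff.mp hg
    obtain ⟨x, hx⟩ := D.toZ_surjective (Multiplicative.ofAdd k)
    refine ⟨x, ?_⟩
    change D.toZ (g * (x ^ l)⁻¹) = 1
    rw [map_mul, map_inv, map_pow, hx, ← hk, ← ofAdd_nsmul, ← ofAdd_zsmul, mul_inv_eq_one, smul_eq_mul, nsmul_eq_mul,
      mul_comm]
  · rintro ⟨x, hx⟩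
    have h1 : D.toZ (g * (x ^ l)⁻¹) = 1 := hx
    rw [map_mul, map_inv, map_pow, mul_inv_eq_one] at h1
    change D.toZ g ∈ lZ l
    rw [h1, ← ofAdd_toAdd (D.toZ x), ← ofAdd_nsmul, nsmul_eq_mul]
    refine Subgroup.mem_zpowers_iff.mpr ⟨Multiplicative.toAdd (D.toZ x), ?_⟩
    rw [← ofAdd_zsmul, smul_eq_mul, mul_comm]

variable {D l} in
/-- **Every automorphism of `Π^tp_X` stabilising `Π^tp_Y` stabilises `Π^tp_X̲ = toZ⁻¹(l·ℤ)`** (it induces an automorphism of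
`Gal(Y/X) ≅ ℤ`, which preserves `l·ℤ`; proved via `mem_GtpXu_iff_exists_pow`).  Pure group theory. [cite: MochizukiEtTh2009, Def 2.5 (i) p.39] -/
theorem map_GtpXu_eq_of_map_GtpY_eq (φ : D.PiTemp ≃* D.PiTemp) (h : D.GtpY.map φ.toMonoidHom = D.GtpY) :
    (D.GtpXu l).map φ.toMonoidHom = D.GtpXu l := by
  -- `φ` and `φ⁻¹` preserve `Π^tp_Y`
  have hφ : ∀ y ∈ D.GtpY, φ y ∈ D.GtpY := fun y hy => h ▸ Subgroup.mem_map_of_mem _ hy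
  have hφ' : ∀ y ∈ D.GtpY, φ.symm y ∈ D.GtpY := fun y hy => by
    rw [← h] at hy
    exact (Subgroup.mem_map_equiv).mp hy
  ext g
  rw [Subgroup.mem_map_equiv, D.mem_GtpXu_iff_exists_pow, D.mem_GtpXu_iff_exists_pow]
  constructor
  · rintro ⟨x, hx⟩
    refine ⟨φ x, ?_⟩
    have := hφ _ hx
    simpa [map_mul, map_inv, map_pow] using this
  · rintro ⟨y, hy⟩
    refine ⟨φ.symm y, ?_⟩
    have := hφ' _ hy
    simpa [map_mul, map_inv, map_pow] using this

end ThetaSetting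

namespace MuTwoSetting

variable {p : ℕ} [Fact p.Prime] {M : MuTwoSetting p} (l : ℕ)

/-- **`[Π^tp_C : Π^tp_X̲] = 2·l`** at the [EtTh] model: `[Π^tp_C : Π^tp_X] = 2` (abc-iut-L2-t1's `index_range_inclX`) times
`[Π^tp_X : Π^tp_X̲] = l` (abc-iut-L2-t7's `index_GtpXu`), `inclX` injective.  PROVED. [cite: MochizukiEtTh2009, Def 2.1 p.36] -/
theorem index_map_inclX_GtpXu (M : MuTwoSetting p) : ((M.GtpXu l).map M.inclX).index = 2 * l := by
  rw [Subgroup.index_map, (MonoidHom.ker_eq_bot_iff M.inclX).mpr M.injective_inclX, sup_bot_eq,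
    M.index_range_inclX, M.index_GtpXu l, mul_comm]

namespace CLevelData

variable (e : M.CLevelData)

/-- **`Π^tp_X̲` is stable under the inner automorphisms of `Π^tp_C`** (restricted to `Π^tp_X` by abc-iut-L2-d3's `conjX`), granted
the printed definition of `Z` (`Thm16Sub.KerToZIsCompactlyGenerated`, through which `Π^tp_Y` is stable, `map_GtpY_conjX`).  PROVED.
[cite: MochizukiEtTh2009, Def 2.5 (i) p.39] -/
theorem map_GtpXu_conjX (h : Thm16Sub.KerToZIsCompactlyGenerated M.toThetaSetting) (g : M.GtpC) :
    (M.GtpXu l).map (e.conjX g).toMulEquiv.toMonoidHom = M.GtpXu l :=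
  M.toThetaSetting.map_GtpXu_eq_of_map_GtpY_eq (e.conjX g).toMulEquiv (e.map_GtpY_conjX h g)

include e in
/-- **`Π^tp_{X̲_v} ⊴ Π^tp_{C_v}`** at the [EtTh] model — the tempered, Π-level form of print's "`Δ̂^±_v` [is] a normal open subgroup of
`Δ̂^cor_v`" / `Π^±_v ⊆ Π^cor_v` ([IUTchII] Def. 2.3 (i); `Π^±_v = Π^tp_{X̲_v}` per F-L6t19g5-1): the image of `Π^tp_X̲` in `Π^tp_C` is
normal, granted the printed definition of `Z`.  PROVED. ([IUTchII] Def 2.3 (i), kurims p.67) [claim: Mochizuki2012, status: disputed] -/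
theorem map_inclX_GtpXu_normal (h : Thm16Sub.KerToZIsCompactlyGenerated M.toThetaSetting) :
    ((M.GtpXu l).map M.inclX).Normal := by
  refine ⟨fun z hz g => ?_⟩
  obtain ⟨y, hy, rfl⟩ := hz
  refine ⟨e.conjX g y, ?_, e.inclX_conjX g y⟩
  have hmem : e.conjX g y ∈ (M.GtpXu l).map (e.conjX g).toMulEquiv.toMonoidHom := ⟨y, hy, rfl⟩
  rwa [e.map_GtpXu_conjX l h g] at hmem

/-- `Δ^tp_C ∩ Π^tp_X = Δ^tp_X` inside `Π^tp_C` (`augC ∘ inclX = aug`): the geometric part of the range of `inclX` is the image of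
`Δ^tp_X`. [cite: MochizukiEtTh2009, §2 p.36] -/
theorem range_inclX_inf_ker_augC :
    M.inclX.range ⊓ e.augC.toMonoidHom.ker = M.DeltaTemp.map M.inclX := by
  ext z
  constructor
  · rintro ⟨⟨y, rfl⟩, hz⟩
    refine ⟨y, ?_, rfl⟩
    change M.aug y = 1
    have : e.augC (M.inclX y) = 1 := hz
    rwa [e.augC_inclX] at this
  · rintro ⟨y, hy, rfl⟩
    refine ⟨⟨y, rfl⟩, ?_⟩
    change e.augC (M.inclX y) = 1
    rw [e.augC_inclX]
    exact hy

/-- For a subgroup `H ≤ Π^tp_X`: `Δ^tp_C ∩ inclX(H) = inclX(Δ^tp_X ∩ H)`. [cite: MochizukiEtTh2009, §2 p.36] -/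
theorem map_inclX_inf_ker_augC (H : Subgroup M.PiTemp) :
    H.map M.inclX ⊓ e.augC.toMonoidHom.ker = (M.DeltaTemp ⊓ H).map M.inclX := by
  ext z
  constructor
  · rintro ⟨⟨y, hy, rfl⟩, hz⟩
    refine ⟨y, Subgroup.mem_inf.mpr ⟨?_, hy⟩, rfl⟩
    change M.aug y = 1
    have : e.augC (M.inclX y) = 1 := hz
    rwa [e.augC_inclX] at this
  · rintro ⟨y, hy, rfl⟩
    refine ⟨⟨y, (Subgroup.mem_inf.mp hy).2, rfl⟩, ?_⟩
    change e.augC (M.inclX y) = 1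
    rw [e.augC_inclX]
    exact (Subgroup.mem_inf.mp hy).1

/-- **`[Δ^tp_C : Δ^tp_X] = 2`** — `X → C` is a GEOMETRIC double covering ("the natural action of `±1`", [EtTh] Def. 1.7; "`ι ∈ Δ_C`",
§2 p. 36): `Π^tp_X` is normal of prime index `2` in `Π^tp_C` and the geometric subgroup `Δ^tp_C = Ker(augC)` is NOT contained in it
(abc-iut-L2-d3's `exists_geometric_not_mem_range`), so `[Δ^tp_C : Δ^tp_C ∩ Π^tp_X] = 2` (abc-iut-L6-t19's
`relIndex_eq_of_prime_relIndex_of_not_le`).  PROVED. [cite: MochizukiEtTh2009, Def 1.7 p.27] -/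
theorem relIndex_range_deltaC : M.inclX.range.relIndex e.augC.toMonoidHom.ker = 2 := by
  haveI : M.inclX.range.Normal := M.range_inclX_normal
  haveI : (M.inclX.range.subgroupOf (⊤ : Subgroup M.GtpC)).Normal := Subgroup.Normal.subgroupOf ‹_› ⊤
  have hidx : M.inclX.range.relIndex (⊤ : Subgroup M.GtpC) = 2 := by
    rw [Subgroup.relIndex_top_right]
    exact M.index_range_inclX
  obtain ⟨ι, hι, hι1⟩ := e.exists_geometric_not_mem_range
  have hnot : ¬ e.augC.toMonoidHom.ker ≤ M.inclX.range := fun hle => hι (hle (by exact hι1))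
  exact Literature.IUT.HodgeArakelov.relIndex_eq_of_prime_relIndex_of_not_le Nat.prime_two hidx le_top hnot

/-- **`[Δ^tp_{C_v} : Δ^tp_{X̲_v}] = 2·l` at the [EtTh] model** — print's "`Δ̂^±_v` [is] a normal open subgroup of `Δ̂^cor_v` of index
`2l`" ([IUTchII] Def. 2.3 (i)) at the tempered level, what abc-iut-L6-t1's `PlusMinusTower.deltaPmHat_index` quotes:
`[Δ^tp_C : Δ^tp_X] · [Δ^tp_X : Δ^tp_{X̲}] = 2 · l` (`relIndex_range_deltaC` and abc-iut-L6-t19's `relIndex_GtpXu_deltaTemp`, transported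
along the injective `inclX`).  PROVED. ([IUTchII] Def 2.3 (i), kurims p.67) [claim: Mochizuki2012, status: disputed] -/
theorem relIndex_map_inclX_GtpXu_deltaC :
    ((M.GtpXu l).map M.inclX).relIndex e.augC.toMonoidHom.ker = 2 * l := by
  have hXU : (M.GtpXu l).map M.inclX ≤ M.inclX.range := Subgroup.map_le_range _ _
  -- the chain `Δ_C ∩ Π_X̲ ≤ Δ_C ∩ Π_X ≤ Δ_C`
  have hmul := Subgroup.relIndex_mul_relIndex ((M.GtpXu l).map M.inclX ⊓ e.augC.toMonoidHom.ker)
    (M.inclX.range ⊓ e.augC.toMonoidHom.ker) e.augC.toMonoidHom.ker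
    (inf_le_inf_right e.augC.toMonoidHom.ker hXU) inf_le_right
  rw [Subgroup.inf_relIndex_right, Subgroup.inf_relIndex_right, e.relIndex_range_deltaC] at hmul
  -- `[Δ_C ∩ Π_X : Δ_C ∩ Π_X̲] = [Δ_X : Δ_X ∩ Π_X̲] = l` (transport along the injective `inclX`)
  have hker : M.inclX.ker = ⊥ := (MonoidHom.ker_eq_bot_iff M.inclX).mpr M.injective_inclX
  have h1 : ((M.GtpXu l).map M.inclX ⊓ e.augC.toMonoidHom.ker).relIndex
      (M.inclX.range ⊓ e.augC.toMonoidHom.ker) = l := by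
    rw [e.map_inclX_inf_ker_augC (M.GtpXu l), e.range_inclX_inf_ker_augC, Subgroup.relIndex_map_map, hker,
      sup_bot_eq, sup_bot_eq, inf_comm, Subgroup.inf_relIndex_right]
    exact M.toThetaSetting.relIndex_GtpXu_deltaTemp l
  rw [h1] at hmul
  rw [← hmul, mul_comm]

end CLevelData

/-- **`[Δ^tp_{X̲_v} : Δ^tp_{X̲̲_v}] = l` inside `Π^tp_C`** (transport along the injective `inclX` of abc-iut-L6-t19's
`DoubleUnderline.relIndex_Huu_deltaTemp_inf_GtpXu`): what `PlusMinusTower.deltaHat_index` quotes, at the tempered level of the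
model, now placed in the ambient `Π^tp_{C_v}`.  PROVED. ([IUTchII] Def 2.3 (i), kurims p.67) [claim: Mochizuki2012, status: disputed] -/
theorem relIndex_map_inclX_Huu {E : M.toThetaSetting.EtaleThetaData} (C : E.DoubleUnderline l) :
    (C.Huu.map M.inclX).relIndex ((M.DeltaTemp ⊓ M.GtpXu l).map M.inclX) = l := by
  have hker : M.inclX.ker = ⊥ := (MonoidHom.ker_eq_bot_iff M.inclX).mpr M.injective_inclX
  rw [Subgroup.relIndex_map_map, hker, sup_bot_eq, sup_bot_eq]
  exact C.relIndex_Huu_deltaTemp_inf_GtpXu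


end MuTwoSetting

end Literature.AnabelianGeometry.EtaleTheta

end
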